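import Literature.AlgebraicGeometry.ComplexMultiplication.CyclotomicFermatCMTypesTwoPrimeLevelSimple
import Mathlib.NumberTheory.LegendreSymbol.QuadraticChar.Basic
import HarnessLib

/-!
# Koblitz–Rohrlich's count of the bad odd characters, EXACT form — `S₀(N) = ⋃_{p ∣ N} {lifts of ψ mod N_p odd with ψ(p) = 1}`, the exact
# count at two-prime levels, and the printed values `s(55) = 3/20`, `s(21) = 1/6`, `s(39) = 1/4` (§2 Remarks 1–2)

Layer `Literature/AlgebraicGeometry/ComplexMultiplication`, namespace `…ComplexMultiplication.CyclotomicFermatCMType`; sequel of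
`CyclotomicFermatCMTypesBadOddCharacterCount` (the injection `χ ↦ (p, χ₀)`, `#S₀(N) ≤ Σ_p #{ψ mod N_p odd : ψ(p) = 1}`) and
`CyclotomicFermatCMTypesTwoPrimeLevelSimple` (one side `A(m; qᵇ) = #{ψ mod qᵇ odd : ψ(m) = 1}`: dichotomy, killing by a power `≡ −1`).
THEOREMS ONLY (no definition, no named fact, no `sorry`).

THE SOURCE.  N. Koblitz, D. Rohrlich, *Simple factors in the Jacobian of a Fermat curve*, Canad. J. Math. **30** (1978) 1183–1205, §2.
Proof of the Proposition (p. 1190): "For `χ ∈ S(N)` let `N₀ | N` be the conductor of `χ`, and let `χ₀` be the character mod `N₀` which induces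
`χ`.  Then `B_{1,χ} = B_{1,χ₀} ∏_{p|N} (1 − χ₀(p))`.  Thus `χ ∈ S₀(N)` if and only if there exists `p | N/N₀` such that `χ₀(p) = 1`. … For
fixed `i`, the number of such `χ₀` is `0` if `pᵢ` is a root of `−1 mod Nᵢ`, `½·#((ℤ/Nᵢℤ)*/{pᵢʲ})` otherwise.  Thus, `s(N) = #S₀(N)/#S(N) ≤ Σᵢ
1/((pᵢ − 1)·ordᵢ)`."  REMARKS (pp. 1192–1193): "1. When `N = 55`, `#S(N) = ½φ(N) = 20`, and `#S₀(N) = 3` (namely, `S₀(N)` consists of: both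
odd characters mod `5` and the Legendre character mod `11`).  Thus, `s(55) = 3/20`. It is clear from the above proof that `3/20` is the
maximum for `s(N)`. It is also clear that `lim s(N) = 0`.  2. If `N` is odd and `3|N`, it can similarly be proved that there are precisely
two values of `N` for which `s(N) ≥ 1/6`: `s(21) = 1/6`, `s(39) = 1/4`."

THIS FILE makes the structural count EXACT (the sibling typed only the inequality it needed): §1 the converse of the sibling's injection
(the lift of an odd `ψ` modulo `d ∣ N` with `ψ(p) = 1`, `p ∣ N`, `p ∤ d`, is an odd character modulo `N` with `B_{1,χ} = 0`) and the resulting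
characterisation of `S₀(N)` at every `N`; §2 the exact count at two-prime levels `N = pᵃqᵇ` (the two families of lifts are disjoint — a
character induced from both `qᵇ` and `pᵃ` has conductor `1` and is even): **`#S₀(N) = A(p; qᵇ) + A(q; pᵃ)`**; §3 the side counts as
numbers (`2·ord·A = φ(M)` when the order of `m` is odd, `#S(N) = φ(N)/2`); §4 **Remark 1 as theorems**: `#S(55) = 20`, `#S₀(55) = 3`,
`s(55) = 3/20`, with "namely": the lifts of BOTH odd characters mod `5` and of the LEGENDRE character mod `11` are bad, the latter being the
unique odd character mod `11` trivial at `5`; §5 **Remark 2's two values**: `#S₀(21) = 1`, `#S(21) = 6`, `s(21) = 1/6` and `#S₀(39) = 3`,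
`#S(39) = 12`, `s(39) = 1/4` — so the Proposition's inequality `12·#S₀(N) < φ(N)` (the hypothesis of the odd-level Theorems 1–2 of
`CyclotomicFermatCMTypesOddLevelSimple`) FAILS at exactly these two levels among those computed (`not_twelve_mul_card_bad_lt_totient_21/39`).

## Honest column / NOT here

* "`3/20` is the maximum for `s(N)`" and "`lim s(N) = 0`" (Remark 1) are NOT typed (the first is a re-run of Cases 1–5 with the constant
  `3/20`; the second an asymptotic of the orders `ordᵢ`); of Remark 2 only the two printed VALUES are typed here — the claim that `s(N) < 1/6`
  at every OTHER odd `N` with `3 ∣ N` ("it can similarly be proved") is left to the sequel `…ThreeTimesPrimePowerLevelSimple` (two-prime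
  levels `3ᵃqᵇ`) and beyond.
* The Legendre character mod `11` is Mathlib's `quadraticChar (ZMod 11)` composed with `ℤ → ℂ`; "both odd characters mod `5`" = all `ψ`
  mod `5` with `ψ(−1) = −1` (there are exactly two: `2·#S(5) = φ(5)`).
* Counts are `Nat.card` of subtypes of `DirichletCharacter ℂ M`, as in the siblings; `s(N)` is written as the rational number
  `#S₀(N)/#S(N)`.
* Private: `odd_changeLevel`, `odd_of_changeLevel`, `not_odd_of_changeLevel_eq_changeLevel`, `card_side_eq_card_unit'`,
  `pow_ne_neg_one_of_odd_orderOf`, the `decide` facts.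

## References

* [KoblitzRohrlich1978] N. Koblitz, D. Rohrlich, Canad. J. Math. 30 (1978) 1183–1205: §2 Proposition, proof (p. 1190), Remarks 1–2
  (pp. 1192–1193).
* [Washington1997] L. C. Washington, *Introduction to Cyclotomic Fields*, Cor. 4.4, Thm. 4.2 (through the siblings: `B_{1,χ₀} ≠ 0`).

## Provenance

Cell `pub-hodgecm2` (COR-CM), literature seat `lit-deligne-3` gen 35 (claim KR78-EXACTCOUNT; count-neutral, own lane).
-/

noncomputable section

open NumberField

namespace Literature.AlgebraicGeometry.ComplexMultiplication

open Literature.NumberTheory.ComplexMultiplication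
open Literature.NumberTheory.LFunctions
open DirichletCharacter

namespace CyclotomicFermatCMType

open AokiFermatCMType

/-! ## §1 The converse injection: lifts of odd characters trivial at `p` are bad; `S₀(N)` exactly -/

section Converse

variable {N : ℕ} [NeZero N]

omit [NeZero N] in
/-- The lift of an odd character is odd. [folklore] -/
private theorem odd_changeLevel {d : ℕ} (hd : d ∣ N) {ψ : DirichletCharacter ℂ d} (hψ : ψ.Odd) :
    (changeLevel hd ψ).Odd := by
  rw [DirichletCharacter.Odd]
  have h := changeLevel_eq_cast_of_dvd' ψ hd (show IsCoprime (-1 : ℤ) (N : ℤ) from isCoprime_one_left.neg_left)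
  rw [Int.cast_neg, Int.cast_one, Int.cast_neg, Int.cast_one] at h
  rw [h]
  exact hψ

omit [NeZero N] in
/-- A character whose lift is odd is odd. [folklore] -/
private theorem odd_of_changeLevel {d : ℕ} (hd : d ∣ N) {ψ : DirichletCharacter ℂ d} (hχ : (changeLevel hd ψ).Odd) :
    ψ.Odd := by
  rw [DirichletCharacter.Odd] at hχ ⊢
  have h := changeLevel_eq_cast_of_dvd' ψ hd (show IsCoprime (-1 : ℤ) (N : ℤ) from isCoprime_one_left.neg_left)
  rw [Int.cast_neg, Int.cast_one, Int.cast_neg, Int.cast_one] at h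
  rw [← h]
  exact hχ

/-- **"`χ ∈ S₀(N)` if … there exists `p | N/N₀` such that `χ₀(p) = 1`", the converse direction**: if `ψ` is an ODD character modulo a
divisor `d` of `N` and `p` is a prime factor of `N` not dividing `d` with `ψ(p) = 1`, then the lift `χ = ψ ∘ (mod d)` of `ψ` to level `N`
has `B_{1,χ} = 0` (the primitive character `χ₀` of `χ` is that of `ψ`, and `χ₀(p) = ψ(p) = 1` since `p` is prime to `d`; then the Euler
factor `1 − χ₀(p)` vanishes). [cite: KoblitzRohrlich1978, §2 proof of the Proposition (p. 1190)] -/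
theorem bernoulliOneChar_changeLevel_eq_zero_of_apply_eq_one {d : ℕ} [NeZero d] (hd : d ∣ N) {p : ℕ}
    (hp : p ∈ N.primeFactors) (hpd : ¬p ∣ d) {ψ : DirichletCharacter ℂ d} (hψ : ψ.Odd) (h1 : ψ (p : ZMod d) = 1) :
    bernoulliOneChar (changeLevel hd ψ) = 0 := by
  have hpp : p.Prime := Nat.prime_of_mem_primeFactors hp
  rw [bernoulliOneChar_eq_zero_iff_of_odd (odd_changeLevel hd hψ)]
  refine ⟨p, hp, ?_⟩
  have hcop : IsCoprime (p : ℤ) (d : ℤ) := Nat.isCoprime_iff_coprime.2 (hpp.coprime_iff_not_dvd.2 hpd)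
  have h := primitiveCharacter_changeLevel_apply hd ψ (p : ℤ)
  rw [primitiveCharacter_apply_of_isCoprime ψ hcop] at h
  simp only [Int.cast_natCast] at h
  rw [h]
  exact h1

/-- The same at the level `N_p = N/p^{v_p(N)}` of the sibling's injection: the lift of an odd `ψ` modulo `N_p` with `ψ(p) = 1` is bad.
[cite: KoblitzRohrlich1978, §2 proof of the Proposition (p. 1190)] -/
theorem bernoulliOneChar_changeLevel_ordCompl_eq_zero {p : ℕ} (hp : p ∈ N.primeFactors) [NeZero (ordCompl[p] N)]
    {ψ : DirichletCharacter ℂ (ordCompl[p] N)} (hψ : ψ.Odd) (h1 : ψ (p : ZMod (ordCompl[p] N)) = 1) :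
    bernoulliOneChar (changeLevel (Nat.ordCompl_dvd N p) ψ) = 0 :=
  bernoulliOneChar_changeLevel_eq_zero_of_apply_eq_one _ hp
    (Nat.not_dvd_ordCompl (Nat.prime_of_mem_primeFactors hp) (NeZero.ne N)) hψ h1

/-- **`S₀(N)` EXACTLY** ("Thus `χ ∈ S₀(N)` if and only if there exists `p | N/N₀` such that `χ₀(p) = 1`"): a character `χ` modulo `N` is
odd with `B_{1,χ} = 0` iff it is the lift of an odd character `ψ` modulo `N_p = N/p^{v_p(N)}` with `ψ(p) = 1` for some prime `p ∣ N` (the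
sibling's `exists_changeLevel_eq_of_odd_of_bernoulliOneChar_eq_zero` and §1). [cite: KoblitzRohrlich1978, §2 proof of the Proposition (p. 1190)] -/
theorem odd_and_bernoulliOneChar_eq_zero_iff_exists_changeLevel {χ : DirichletCharacter ℂ N} :
    (χ.Odd ∧ bernoulliOneChar χ = 0) ↔
      ∃ p ∈ N.primeFactors, ∃ (_ : NeZero (ordCompl[p] N)) (ψ : DirichletCharacter ℂ (ordCompl[p] N)),
        ψ.Odd ∧ ψ (p : ZMod (ordCompl[p] N)) = 1 ∧ changeLevel (Nat.ordCompl_dvd N p) ψ = χ := by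
  constructor
  · rintro ⟨hodd, h0⟩
    exact exists_changeLevel_eq_of_odd_of_bernoulliOneChar_eq_zero hodd h0
  · rintro ⟨p, hp, _, ψ, hψ, h1, rfl⟩
    exact ⟨odd_changeLevel _ hψ, bernoulliOneChar_changeLevel_ordCompl_eq_zero hp hψ h1⟩

end Converse

/-! ## §2 The exact count at two-prime levels `N = pᵃqᵇ`: `#S₀(N) = A(p; qᵇ) + A(q; pᵃ)` -/

section TwoPrimesExact

variable {p q a b N : ℕ} [hp : Fact p.Prime] [hq : Fact q.Prime] [NeZero N]

/-- At `N = pᵃqᵇ`: an odd character modulo `N` with `B_{1,χ} = 0` is induced from `qᵇ` by an odd `ψ` with `ψ(p) = 1`, or from `pᵃ` by an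
odd `ψ` with `ψ(q) = 1` (K–R's `χ₀(p) = 1` for some `p ∣ N/N₀`: that prime is `p` or `q`, and the conductor is then prime to it).
[cite: KoblitzRohrlich1978, §2 proof of the Proposition (p. 1190)] -/
theorem exists_changeLevel_eq_of_bad_twoPrimes (hpq : p ≠ q) (hN : N = p ^ a * q ^ b) {χ : DirichletCharacter ℂ N}
    (hodd : χ.Odd) (h0 : bernoulliOneChar χ = 0) :
    (∃ ψ : DirichletCharacter ℂ (q ^ b), ψ.Odd ∧ ψ (p : ZMod (q ^ b)) = 1 ∧
        changeLevel (show q ^ b ∣ N from hN ▸ Dvd.intro_left _ rfl) ψ = χ) ∨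
      ∃ ψ : DirichletCharacter ℂ (p ^ a), ψ.Odd ∧ ψ (q : ZMod (p ^ a)) = 1 ∧
        changeLevel (show p ^ a ∣ N from hN ▸ Dvd.intro _ rfl) ψ = χ := by
  haveI : NeZero (q ^ b) := ⟨pow_ne_zero b hq.out.ne_zero⟩
  haveI : NeZero (p ^ a) := ⟨pow_ne_zero a hp.out.ne_zero⟩
  haveI : NeZero χ.conductor := ⟨χ.conductor_ne_zero⟩
  obtain ⟨r, hr, hχr⟩ := (bernoulliOneChar_eq_zero_iff_of_odd hodd).1 h0
  have hrprime : r.Prime := Nat.prime_of_mem_primeFactors hr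
  -- `r ∤ cond χ`
  have hrc : ¬r ∣ χ.conductor := by
    intro hd
    have hnu : ¬IsUnit ((r : ℕ) : ZMod χ.conductor) := by
      rw [ZMod.isUnit_iff_coprime, hrprime.coprime_iff_not_dvd]
      exact fun h => h hd
    rw [MulChar.map_nonunit _ hnu] at hχr
    exact zero_ne_one hχr
  have hcN : χ.conductor ∣ p ^ a * q ^ b := hN ▸ χ.conductor_dvd_level
  -- `r = p` or `r = q`
  have hrpq : r = p ∨ r = q := by
    have hrN : r ∣ p ^ a * q ^ b := hN ▸ Nat.dvd_of_mem_primeFactors hr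
    rcases (Nat.Prime.dvd_mul hrprime).1 hrN with h | h
    · exact Or.inl ((Nat.prime_dvd_prime_iff_eq hrprime hp.out).1 (hrprime.dvd_of_dvd_pow h))
    · exact Or.inr ((Nat.prime_dvd_prime_iff_eq hrprime hq.out).1 (hrprime.dvd_of_dvd_pow h))
  -- the generic step: `cond χ ∣ d`, `d ∣ N`, `r ∤ d` coprime ⟹ `χ` is the lift of an odd `ψ` mod `d` with `ψ(r) = 1`
  have step : ∀ {d : ℕ} [NeZero d] (hdN : d ∣ N), χ.conductor ∣ d → r.Coprime d →
      ∃ ψ : DirichletCharacter ℂ d, ψ.Odd ∧ ψ (r : ZMod d) = 1 ∧ changeLevel hdN ψ = χ := by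
    intro d _ hdN hcd hrd
    obtain ⟨_, ψ, hψ⟩ := (mem_conductorSet_iff_conductor_dvd χ hdN).2 hcd
    refine ⟨ψ, odd_of_changeLevel hdN (hψ ▸ hodd), ?_, hψ.symm⟩
    have hcop : IsCoprime (r : ℤ) (d : ℤ) := Nat.isCoprime_iff_coprime.2 hrd
    have h := primitiveCharacter_changeLevel_apply hdN ψ (r : ℤ)
    rw [← hψ, primitiveCharacter_apply_of_isCoprime ψ hcop] at h
    simp only [Int.cast_natCast] at h
    rw [← h]
    exact hχr
  have hcopq : (p ^ a).Coprime (q ^ b) := (((Nat.coprime_primes hp.out hq.out).2 hpq).pow_right b).pow_left a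
  rcases hrpq with rfl | rfl
  · -- `r = p`: `cond χ` is prime to `pᵃ`, so divides `qᵇ`
    left
    have hcp : χ.conductor.Coprime (r ^ a) := Nat.Coprime.pow_right a ((hrprime.coprime_iff_not_dvd.2 hrc).symm)
    exact step _ (hcp.dvd_of_dvd_mul_left hcN) (((Nat.coprime_primes hrprime hq.out).2 hpq).pow_right b)
  · -- `r = q`
    right
    have hcp : χ.conductor.Coprime (r ^ b) := Nat.Coprime.pow_right b ((hrprime.coprime_iff_not_dvd.2 hrc).symm)
    exact step _ (hcp.dvd_of_dvd_mul_right hcN) (((Nat.coprime_primes hrprime hp.out).2 hpq.symm).pow_right a)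

/-- At `N = pᵃqᵇ` no ODD character is induced from both `qᵇ` and `pᵃ` (its conductor would divide `gcd(qᵇ, pᵃ) = 1`, making it the trivial,
even, character). [folklore] -/
private theorem not_odd_of_changeLevel_eq_changeLevel (hpq : p ≠ q) (hN : N = p ^ a * q ^ b) {ψ₁ : DirichletCharacter ℂ (q ^ b)}
    {ψ₂ : DirichletCharacter ℂ (p ^ a)}
    (h : changeLevel (show q ^ b ∣ N from hN ▸ Dvd.intro_left _ rfl) ψ₁ =
      changeLevel (show p ^ a ∣ N from hN ▸ Dvd.intro _ rfl) ψ₂) :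
    ¬(changeLevel (show q ^ b ∣ N from hN ▸ Dvd.intro_left _ rfl) ψ₁).Odd := by
  haveI : NeZero (q ^ b) := ⟨pow_ne_zero b hq.out.ne_zero⟩
  haveI : NeZero (p ^ a) := ⟨pow_ne_zero a hp.out.ne_zero⟩
  have h1 : (changeLevel (show q ^ b ∣ N from hN ▸ Dvd.intro_left _ rfl) ψ₁).conductor ∣ q ^ b := by
    rw [conductor_changeLevel]
    exact ψ₁.conductor_dvd_level
  have h2 : (changeLevel (show q ^ b ∣ N from hN ▸ Dvd.intro_left _ rfl) ψ₁).conductor ∣ p ^ a := by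
    rw [h, conductor_changeLevel]
    exact ψ₂.conductor_dvd_level
  have hcop : (p ^ a).Coprime (q ^ b) := (((Nat.coprime_primes hp.out hq.out).2 hpq).pow_right b).pow_left a
  have hc1 : (changeLevel (show q ^ b ∣ N from hN ▸ Dvd.intro_left _ rfl) ψ₁).conductor = 1 :=
    Nat.eq_one_of_dvd_coprimes hcop h2 h1
  rw [← eq_one_iff_conductor_eq_one] at hc1
  rw [hc1]
  intro hodd
  rw [DirichletCharacter.Odd, MulChar.one_apply isUnit_one.neg] at hodd
  norm_num at hodd

/-- **THE EXACT COUNT AT TWO-PRIME LEVELS**: for distinct primes `p, q` and `N = pᵃqᵇ`,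
`#{χ mod N odd : B_{1,χ} = 0} = #{ψ mod qᵇ odd : ψ(p) = 1} + #{ψ mod pᵃ odd : ψ(q) = 1}` — Koblitz–Rohrlich's count `Σᵢ` of odd `χ₀`
modulo `Nᵢ` with `χ₀(pᵢ) = 1`, which at two-prime levels is an EQUALITY (the two families of lifts exhaust `S₀(N)` and are disjoint).
[cite: KoblitzRohrlich1978, §2 proof of the Proposition (p. 1190)] -/
theorem card_bad_eq_card_sides_twoPrimes (hpq : p ≠ q) (ha : a ≠ 0) (hb : b ≠ 0) (hN : N = p ^ a * q ^ b) :
    Nat.card {χ : DirichletCharacter ℂ N // χ.Odd ∧ bernoulliOneChar χ = 0} =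
      Nat.card {ψ : DirichletCharacter ℂ (q ^ b) // ψ.Odd ∧ ψ (p : ZMod (q ^ b)) = 1} +
        Nat.card {ψ : DirichletCharacter ℂ (p ^ a) // ψ.Odd ∧ ψ (q : ZMod (p ^ a)) = 1} := by
  classical
  haveI : NeZero (q ^ b) := ⟨pow_ne_zero b hq.out.ne_zero⟩
  haveI : NeZero (p ^ a) := ⟨pow_ne_zero a hp.out.ne_zero⟩
  have hqN : q ^ b ∣ N := hN ▸ Dvd.intro_left _ rfl
  have hpN : p ^ a ∣ N := hN ▸ Dvd.intro _ rfl
  have hN0 : N ≠ 0 := NeZero.ne N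
  have hpmem : p ∈ N.primeFactors :=
    Nat.mem_primeFactors.2 ⟨hp.out, hN ▸ dvd_mul_of_dvd_left (dvd_pow_self p ha) _, hN0⟩
  have hqmem : q ∈ N.primeFactors :=
    Nat.mem_primeFactors.2 ⟨hq.out, hN ▸ dvd_mul_of_dvd_right (dvd_pow_self q hb) _, hN0⟩
  have hpq' : ¬p ∣ q ^ b := fun h => hpq ((Nat.prime_dvd_prime_iff_eq hp.out hq.out).1 (hp.out.dvd_of_dvd_pow h))
  have hqp' : ¬q ∣ p ^ a := fun h => hpq.symm ((Nat.prime_dvd_prime_iff_eq hq.out hp.out).1 (hq.out.dvd_of_dvd_pow h))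
  let F₁ : Finset (DirichletCharacter ℂ N) :=
    (Finset.univ.filter fun ψ : DirichletCharacter ℂ (q ^ b) => ψ.Odd ∧ ψ (p : ZMod (q ^ b)) = 1).image (changeLevel hqN)
  let F₂ : Finset (DirichletCharacter ℂ N) :=
    (Finset.univ.filter fun ψ : DirichletCharacter ℂ (p ^ a) => ψ.Odd ∧ ψ (q : ZMod (p ^ a)) = 1).image (changeLevel hpN)
  have hS : (Finset.univ.filter fun χ : DirichletCharacter ℂ N => χ.Odd ∧ bernoulliOneChar χ = 0) = F₁ ∪ F₂ := by
    ext χ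
    simp only [F₁, F₂, Finset.mem_filter, Finset.mem_univ, true_and, Finset.mem_union, Finset.mem_image]
    constructor
    · rintro ⟨hodd, h0⟩
      rcases exists_changeLevel_eq_of_bad_twoPrimes hpq hN hodd h0 with ⟨ψ, hψ, h1, hψχ⟩ | ⟨ψ, hψ, h1, hψχ⟩
      · exact Or.inl ⟨ψ, ⟨hψ, h1⟩, hψχ⟩
      · exact Or.inr ⟨ψ, ⟨hψ, h1⟩, hψχ⟩
    · rintro (⟨ψ, ⟨hψ, h1⟩, rfl⟩ | ⟨ψ, ⟨hψ, h1⟩, rfl⟩)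
      · exact ⟨odd_changeLevel _ hψ, bernoulliOneChar_changeLevel_eq_zero_of_apply_eq_one hqN hpmem hpq' hψ h1⟩
      · exact ⟨odd_changeLevel _ hψ, bernoulliOneChar_changeLevel_eq_zero_of_apply_eq_one hpN hqmem hqp' hψ h1⟩
  have hdisj : Disjoint F₁ F₂ := by
    rw [Finset.disjoint_left]
    intro χ h₁ h₂
    simp only [F₁, F₂, Finset.mem_image, Finset.mem_filter, Finset.mem_univ, true_and] at h₁ h₂
    obtain ⟨ψ₁, ⟨hψ₁, -⟩, rfl⟩ := h₁
    obtain ⟨ψ₂, -, h⟩ := h₂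
    exact not_odd_of_changeLevel_eq_changeLevel hpq hN h.symm (odd_changeLevel _ hψ₁)
  rw [Nat.card_eq_fintype_card, Fintype.card_subtype, hS, Finset.card_union_of_disjoint hdisj,
    Finset.card_image_of_injective _ (changeLevel_injective hqN), Finset.card_image_of_injective _ (changeLevel_injective hpN),
    Nat.card_eq_fintype_card, Fintype.card_subtype, Nat.card_eq_fintype_card, Fintype.card_subtype]

end TwoPrimesExact

/-! ## §3 The side counts and `#S(N)` as numbers -/

section Numbers

variable {M : ℕ} [NeZero M]

omit [NeZero M] in
/-- A unit of odd order has no power equal to `−1` (`M > 2`): `(−1)^{odd} ≠ 1`. [folklore] -/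
private theorem pow_ne_neg_one_of_odd_orderOf (hM : 2 < M) {u : (ZMod M)ˣ} (hodd : Odd (orderOf u)) (j : ℕ) :
    u ^ j ≠ -1 := by
  intro hj
  have h1 : (u ^ j) ^ orderOf u = 1 := by rw [← pow_mul, mul_comm, pow_mul, pow_orderOf_eq_one, one_pow]
  rw [hj, hodd.neg_one_pow] at h1
  have h2 : ((-1 : (ZMod M)ˣ) : ZMod M) = 1 := by rw [h1, Units.val_one]
  rw [Units.val_neg, Units.val_one] at h2
  have h3 : ((2 : ℕ) : ZMod M) = 0 := by
    rw [Nat.cast_ofNat]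
    linear_combination -h2
  rw [ZMod.natCast_eq_zero_iff] at h3
  exact absurd (Nat.le_of_dvd two_pos h3) (not_le.2 hM)

omit [NeZero M] in
/-- Reading `ψ(m) = 1` on the unit `m ∈ (ℤ/M)ˣ` (private copy of the sibling's). [folklore] -/
private theorem card_side_eq_card_unit' {m : ℕ} (hm : m.Coprime M) :
    Nat.card {ψ : DirichletCharacter ℂ M // ψ.Odd ∧ ψ (m : ZMod M) = 1} =
      Nat.card {ψ : DirichletCharacter ℂ M // ψ.Odd ∧ ψ (ZMod.unitOfCoprime m hm) = 1} := by
  refine Nat.card_congr (Equiv.subtypeEquivRight fun ψ => ?_)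
  rw [ZMod.coe_unitOfCoprime]

/-- **The side count as printed, `#{ψ mod M odd : ψ(m) = 1} = ½·#((ℤ/Mℤ)*/{mʲ}) = φ(M)/(2·ord m)`, when the order of `m` is ODD** (`M > 2`; an
odd-order unit is not "a root of `−1`"): `2·ord(m)·#{ψ mod M odd : ψ(m) = 1} = φ(M)`. [cite: KoblitzRohrlich1978, §2 proof of the Proposition (p. 1190)] -/
theorem two_mul_orderOf_mul_card_side_eq_totient (hM : 2 < M) {m : ℕ} (hm : m.Coprime M)
    (hodd : Odd (orderOf (ZMod.unitOfCoprime m hm))) :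
    2 * orderOf (ZMod.unitOfCoprime m hm) * Nat.card {ψ : DirichletCharacter ℂ M // ψ.Odd ∧ ψ (m : ZMod M) = 1} =
      M.totient := by
  rw [card_side_eq_card_unit' hm]
  exact two_mul_orderOf_mul_card_odd_apply_eq_one _ (pow_ne_neg_one_of_odd_orderOf hM hodd)

/-- **`m ≡ 1 (mod M)`: every odd character qualifies** — `2·#{ψ mod M odd : ψ(m) = 1} = φ(M)` (`M > 2`). [cite: KoblitzRohrlich1978, §2 proof of the Proposition (p. 1190)] -/
theorem two_mul_card_side_eq_totient_of_natCast_eq_one (hM : 2 < M) {m : ℕ} (hm : m.Coprime M) (h1 : (m : ZMod M) = 1) :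
    2 * Nat.card {ψ : DirichletCharacter ℂ M // ψ.Odd ∧ ψ (m : ZMod M) = 1} = M.totient := by
  have hu : ZMod.unitOfCoprime m hm = 1 := Units.ext (by rw [ZMod.coe_unitOfCoprime, h1, Units.val_one])
  have h := two_mul_orderOf_mul_card_side_eq_totient hM hm (by rw [hu, orderOf_one]; exact odd_one)
  rwa [hu, orderOf_one, mul_one] at h

omit [NeZero M] in
/-- **A side killed by a power `≡ −1`**: if `mʲ ≡ −1 (mod M)` then `#{ψ mod M odd : ψ(m) = 1} = 0` ("`0` if `pᵢ` is a root of `−1 mod Nᵢ`").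
[cite: KoblitzRohrlich1978, §2 proof of the Proposition (p. 1190)] -/
theorem card_side_eq_zero_of_pow_eq_neg_one {m : ℕ} (hm : m.Coprime M) {j : ℕ} (hj : ((m : ZMod M)) ^ j = -1) :
    Nat.card {ψ : DirichletCharacter ℂ M // ψ.Odd ∧ ψ (m : ZMod M) = 1} = 0 := by
  rw [card_side_eq_card_unit' hm]
  exact card_odd_apply_eq_one_eq_zero _ (Units.ext (by
    rw [Units.val_pow_eq_pow_val, ZMod.coe_unitOfCoprime, Units.val_neg, Units.val_one]; exact hj))

/-- **`#S(N) = φ(N)/2`**: twice the number of odd characters modulo `N > 2` is `φ(N)` (K–R: "`#S(N) = ½φ(N)`"; the side count at `m = 1`).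
[cite: KoblitzRohrlich1978, §2 Remark 1 (p. 1192)] -/
theorem two_mul_card_odd_eq_totient' (hM : 2 < M) :
    2 * Nat.card {χ : DirichletCharacter ℂ M // χ.Odd} = M.totient := by
  have h := two_mul_card_side_eq_totient_of_natCast_eq_one hM (Nat.coprime_one_left M) Nat.cast_one
  have e : Nat.card {ψ : DirichletCharacter ℂ M // ψ.Odd ∧ ψ ((1 : ℕ) : ZMod M) = 1} =
      Nat.card {χ : DirichletCharacter ℂ M // χ.Odd} :=
    Nat.card_congr (Equiv.subtypeEquivRight fun ψ => by rw [Nat.cast_one, map_one]; exact and_iff_left rfl)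
  rwa [e] at h

end Numbers

/-! ## §4 REMARK 1: `N = 55` — `#S(55) = 20`, `#S₀(55) = 3` ("both odd characters mod `5` and the Legendre character mod `11`"), `s(55) = 3/20` -/

section FiftyFive

/-- `5⁵ ≡ 1 (mod 11)` and `5 ≢ 1`: the order of `5` modulo `11` is `5` (kernel computation). [folklore] -/
private theorem five_pow_five_mod_eleven : ((5 : ℕ) : ZMod 11) ^ 5 = 1 ∧ ((5 : ℕ) : ZMod 11) ≠ 1 := by decide

/-- `11 ≡ 1 (mod 5)` (kernel computation). [folklore] -/
private theorem eleven_mod_five : ((11 : ℕ) : ZMod 5) = 1 := by decide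

/-- The order of `5` in `(ℤ/11)ˣ` is `5`. [folklore] -/
private theorem orderOf_five_mod_eleven :
    orderOf (ZMod.unitOfCoprime 5 (show (5 : ℕ).Coprime 11 by norm_num) : (ZMod 11)ˣ) = 5 := by
  haveI : Fact (Nat.Prime 5) := ⟨by norm_num⟩
  refine orderOf_eq_prime (Units.ext ?_) ?_
  · rw [Units.val_pow_eq_pow_val, ZMod.coe_unitOfCoprime, Units.val_one]
    exact five_pow_five_mod_eleven.1
  · intro h
    have h' := congrArg (fun u : (ZMod 11)ˣ => (u : ZMod 11)) h
    simp only [ZMod.coe_unitOfCoprime, Units.val_one] at h'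
    exact five_pow_five_mod_eleven.2 h'

/-- **`A(5; 11) = 1`**: exactly one odd character modulo `11` is trivial at `5` (`ord₁₁(5) = 5`, `2·5·A = φ(11) = 10`).
[cite: KoblitzRohrlich1978, §2 Remark 1 (p. 1192)] -/
theorem card_side_five_mod_eleven : Nat.card {ψ : DirichletCharacter ℂ 11 // ψ.Odd ∧ ψ ((5 : ℕ) : ZMod 11) = 1} = 1 := by
  have h := two_mul_orderOf_mul_card_side_eq_totient (M := 11) (by norm_num) (show (5 : ℕ).Coprime 11 by norm_num)
    (by rw [orderOf_five_mod_eleven]; decide)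
  rw [orderOf_five_mod_eleven, Nat.totient_prime (by norm_num)] at h
  omega

/-- **`A(11; 5) = 2`**: both odd characters modulo `5` are trivial at `11 ≡ 1` (`2·A = φ(5) = 4`). [cite: KoblitzRohrlich1978, §2 Remark 1 (p. 1192)] -/
theorem card_side_eleven_mod_five : Nat.card {ψ : DirichletCharacter ℂ 5 // ψ.Odd ∧ ψ ((11 : ℕ) : ZMod 5) = 1} = 2 := by
  have h := two_mul_card_side_eq_totient_of_natCast_eq_one (M := 5) (by norm_num) (show (11 : ℕ).Coprime 5 by norm_num)
    eleven_mod_five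
  rw [Nat.totient_prime (by norm_num)] at h
  omega

/-- **"both odd characters mod `5`"**: there are exactly two odd characters modulo `5`. [cite: KoblitzRohrlich1978, §2 Remark 1 (p. 1192)] -/
theorem card_odd_five : Nat.card {ψ : DirichletCharacter ℂ 5 // ψ.Odd} = 2 := by
  have h := two_mul_card_odd_eq_totient' (M := 5) (by norm_num)
  rw [Nat.totient_prime (by norm_num)] at h
  omega

/-- **REMARK 1, `#S(55) = ½φ(55) = 20`.** [cite: KoblitzRohrlich1978, §2 Remark 1 (p. 1192)] -/
theorem card_odd_fiftyFive : Nat.card {χ : DirichletCharacter ℂ 55 // χ.Odd} = 20 := by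
  have h := two_mul_card_odd_eq_totient' (M := 55) (by norm_num)
  have h55 : Nat.totient 55 = 40 := by
    rw [show (55 : ℕ) = 5 * 11 from rfl, Nat.totient_mul (by norm_num), Nat.totient_prime (by norm_num),
      Nat.totient_prime (by norm_num)]
  omega

/-- **REMARK 1, `#S₀(55) = 3`.** [cite: KoblitzRohrlich1978, §2 Remark 1 (p. 1192)] -/
theorem card_bad_fiftyFive : Nat.card {χ : DirichletCharacter ℂ 55 // χ.Odd ∧ bernoulliOneChar χ = 0} = 3 := by
  haveI : Fact (Nat.Prime 5) := ⟨by norm_num⟩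
  haveI : Fact (Nat.Prime 11) := ⟨by norm_num⟩
  have h := card_bad_eq_card_sides_twoPrimes (p := 5) (q := 11) (a := 1) (b := 1) (N := 55) (by norm_num) one_ne_zero one_ne_zero
      (by norm_num)
  rw [h, pow_one, pow_one, card_side_five_mod_eleven, card_side_eleven_mod_five]

/-- **REMARK 1, "Thus, `s(55) = 3/20`"** (`s(N) = #S₀(N)/#S(N)`). [cite: KoblitzRohrlich1978, §2 Remark 1 (p. 1192)] -/
theorem s_fiftyFive :
    (Nat.card {χ : DirichletCharacter ℂ 55 // χ.Odd ∧ bernoulliOneChar χ = 0} : ℚ) /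
        Nat.card {χ : DirichletCharacter ℂ 55 // χ.Odd} = 3 / 20 := by
  rw [card_bad_fiftyFive, card_odd_fiftyFive]
  norm_num

/-- **"namely … both odd characters mod `5`"**: the lift to `55` of EVERY odd character modulo `5` is bad (`11 ≡ 1 (mod 5)`, so `χ₀(11) = 1`).
[cite: KoblitzRohrlich1978, §2 Remark 1 (p. 1192)] -/
theorem bernoulliOneChar_changeLevel_eq_zero_of_odd_five (ψ : DirichletCharacter ℂ 5) (hψ : ψ.Odd) :
    bernoulliOneChar (changeLevel (show 5 ∣ 55 by norm_num) ψ) = 0 :=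
  bernoulliOneChar_changeLevel_eq_zero_of_apply_eq_one _ (p := 11)
    (Nat.mem_primeFactors.2 ⟨by norm_num, by norm_num, by norm_num⟩) (by norm_num) hψ (by rw [eleven_mod_five, map_one])

/-- `5 ≢ 0` and `5 = 4·4` modulo `11` (kernel computation). [folklore] -/
private theorem five_mod_eleven_facts : ((5 : ℕ) : ZMod 11) ≠ 0 ∧ ((5 : ℕ) : ZMod 11) = 4 * 4 := by decide

/-- The Legendre character modulo `11` as a complex Dirichlet character (Mathlib's `quadraticChar (ZMod 11)` composed with `ℤ → ℂ`).
It is ODD (`11 ≡ 3 (mod 4)`) and trivial at `5 = 4²` — the two properties behind "the Legendre character mod `11`" `∈ S₀(55)`.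
[cite: KoblitzRohrlich1978, §2 Remark 1 (p. 1192)] -/
theorem legendre_eleven_odd_and_apply_five [Fact (Nat.Prime 11)] :
    DirichletCharacter.Odd ((quadraticChar (ZMod 11)).ringHomComp (Int.castRingHom ℂ)) ∧
      (quadraticChar (ZMod 11)).ringHomComp (Int.castRingHom ℂ) ((5 : ℕ) : ZMod 11) = 1 := by
  constructor
  · show (quadraticChar (ZMod 11)).ringHomComp (Int.castRingHom ℂ) (-1) = -1
    have h2 : ringChar (ZMod 11) ≠ 2 := by rw [ZMod.ringChar_zmod_n]; decide
    rw [MulChar.ringHomComp_apply, quadraticChar_neg_one h2, ZMod.card 11, ZMod.χ₄_nat_three_mod_four (by norm_num)]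
    simp
  · have hsq : IsSquare (((5 : ℕ) : ZMod 11)) := ⟨4, five_mod_eleven_facts.2⟩
    rw [MulChar.ringHomComp_apply, (quadraticChar_one_iff_isSquare five_mod_eleven_facts.1).2 hsq]
    simp

/-- **"namely … the Legendre character mod `11`"**: the lift to `55` of the Legendre character modulo `11` is bad (`χ₀(5) = (5/11) = 1`).
[cite: KoblitzRohrlich1978, §2 Remark 1 (p. 1192)] -/
theorem bernoulliOneChar_changeLevel_legendre_eleven_eq_zero [Fact (Nat.Prime 11)] :
    bernoulliOneChar (changeLevel (show 11 ∣ 55 by norm_num) ((quadraticChar (ZMod 11)).ringHomComp (Int.castRingHom ℂ))) = 0 :=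
  bernoulliOneChar_changeLevel_eq_zero_of_apply_eq_one _ (p := 5)
    (Nat.mem_primeFactors.2 ⟨by norm_num, by norm_num, by norm_num⟩) (by norm_num) legendre_eleven_odd_and_apply_five.1
    legendre_eleven_odd_and_apply_five.2

/-- **The Legendre character is THE odd character modulo `11` trivial at `5`** (`A(5; 11) = 1`). [cite: KoblitzRohrlich1978, §2 Remark 1 (p. 1192)] -/
theorem eq_legendre_of_odd_of_apply_five_eq_one [Fact (Nat.Prime 11)] (ψ : DirichletCharacter ℂ 11) (hψ : ψ.Odd) (h5 : ψ ((5 : ℕ) : ZMod 11) = 1) :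
    ψ = (quadraticChar (ZMod 11)).ringHomComp (Int.castRingHom ℂ) := by
  have h1 := card_side_five_mod_eleven
  rw [Nat.card_eq_one_iff_unique] at h1
  obtain ⟨hsub, _⟩ := h1
  have := hsub.elim ⟨ψ, hψ, h5⟩ ⟨(quadraticChar (ZMod 11)).ringHomComp (Int.castRingHom ℂ), legendre_eleven_odd_and_apply_five⟩
  exact congrArg Subtype.val this

/-- **REMARK 1, complete sentence**: `S₀(55)` CONSISTS of the two lifts of the odd characters mod `5` and the lift of the Legendre character
mod `11` — every odd `χ` modulo `55` with `B_{1,χ} = 0` is one of these, and (above) each of these is bad; with `#S₀(55) = 3`.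
[cite: KoblitzRohrlich1978, §2 Remark 1 (p. 1192)] -/
theorem bad_fiftyFive_cases [Fact (Nat.Prime 11)] {χ : DirichletCharacter ℂ 55} (hodd : χ.Odd) (h0 : bernoulliOneChar χ = 0) :
    (∃ ψ : DirichletCharacter ℂ 5, ψ.Odd ∧ changeLevel (show 5 ∣ 55 by norm_num) ψ = χ) ∨
      changeLevel (show 11 ∣ 55 by norm_num) ((quadraticChar (ZMod 11)).ringHomComp (Int.castRingHom ℂ)) = χ := by
  haveI : Fact (Nat.Prime 5) := ⟨by norm_num⟩
  rcases exists_changeLevel_eq_of_bad_twoPrimes (p := 5) (q := 11) (a := 1) (b := 1) (N := 55) (by norm_num) (by norm_num)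
    hodd h0 with ⟨ψ, hψ, h1, hψχ⟩ | ⟨ψ, hψ, -, hψχ⟩
  · right
    have h11 : 11 ^ 1 ∣ 11 := by norm_num
    have hodd' : (changeLevel h11 ψ).Odd := odd_changeLevel (N := 11) h11 hψ
    have h5 : changeLevel h11 ψ ((5 : ℕ) : ZMod 11) = 1 := by
      have h := changeLevel_eq_cast_of_dvd' ψ h11 (a := (5 : ℕ))
        (Nat.isCoprime_iff_coprime.2 (show (5 : ℕ).Coprime 11 by norm_num))
      simp only [Int.cast_natCast] at h
      rw [h]
      exact h1
    have e := eq_legendre_of_odd_of_apply_five_eq_one _ hodd' h5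
    rw [← e, ← changeLevel_trans ψ h11 (show 11 ∣ 55 by norm_num)]
    exact hψχ
  · left
    have h5 : 5 ^ 1 ∣ 5 := by norm_num
    refine ⟨changeLevel h5 ψ, odd_changeLevel (N := 5) h5 hψ, ?_⟩
    rw [← changeLevel_trans ψ h5 (show 5 ∣ 55 by norm_num)]
    exact hψχ

end FiftyFive

/-! ## §5 REMARK 2's two values: `s(21) = 1/6`, `s(39) = 1/4` — the Proposition's inequality fails there -/

section TwentyOneThirtyNine

/-- `3³ ≡ −1 (mod 7)`: `3` is "a root of `−1`" modulo `7` (kernel computation). [folklore] -/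
private theorem three_cube_mod_seven : ((3 : ℕ) : ZMod 7) ^ 3 = -1 := by decide

/-- `7 ≡ 1 (mod 3)`, `13 ≡ 1 (mod 3)` (kernel computation). [folklore] -/
private theorem seven_thirteen_mod_three : ((7 : ℕ) : ZMod 3) = 1 ∧ ((13 : ℕ) : ZMod 3) = 1 := by decide

/-- `3³ ≡ 1 (mod 13)` and `3 ≢ 1`: the order of `3` modulo `13` is `3` (kernel computation). [folklore] -/
private theorem three_cube_mod_thirteen : ((3 : ℕ) : ZMod 13) ^ 3 = 1 ∧ ((3 : ℕ) : ZMod 13) ≠ 1 := by decide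

/-- **`A(3; 7) = 0`** (`3³ ≡ −1 (mod 7)`). [cite: KoblitzRohrlich1978, §2 Remark 2 (p. 1193)] -/
theorem card_side_three_mod_seven : Nat.card {ψ : DirichletCharacter ℂ 7 // ψ.Odd ∧ ψ ((3 : ℕ) : ZMod 7) = 1} = 0 :=
  card_side_eq_zero_of_pow_eq_neg_one (show (3 : ℕ).Coprime 7 by norm_num) three_cube_mod_seven

/-- **`A(7; 3) = 1`** (`7 ≡ 1 (mod 3)`; the one odd character mod `3`). [cite: KoblitzRohrlich1978, §2 Remark 2 (p. 1193)] -/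
theorem card_side_seven_mod_three : Nat.card {ψ : DirichletCharacter ℂ 3 // ψ.Odd ∧ ψ ((7 : ℕ) : ZMod 3) = 1} = 1 := by
  have h := two_mul_card_side_eq_totient_of_natCast_eq_one (M := 3) (by norm_num) (show (7 : ℕ).Coprime 3 by norm_num)
    seven_thirteen_mod_three.1
  rw [Nat.totient_prime (by norm_num)] at h
  omega

/-- **`A(13; 3) = 1`** (`13 ≡ 1 (mod 3)`). [cite: KoblitzRohrlich1978, §2 Remark 2 (p. 1193)] -/
theorem card_side_thirteen_mod_three : Nat.card {ψ : DirichletCharacter ℂ 3 // ψ.Odd ∧ ψ ((13 : ℕ) : ZMod 3) = 1} = 1 := by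
  have h := two_mul_card_side_eq_totient_of_natCast_eq_one (M := 3) (by norm_num) (show (13 : ℕ).Coprime 3 by norm_num)
    seven_thirteen_mod_three.2
  rw [Nat.totient_prime (by norm_num)] at h
  omega

/-- The order of `3` in `(ℤ/13)ˣ` is `3`. [folklore] -/
private theorem orderOf_three_mod_thirteen :
    orderOf (ZMod.unitOfCoprime 3 (show (3 : ℕ).Coprime 13 by norm_num) : (ZMod 13)ˣ) = 3 := by
  refine orderOf_eq_prime (Units.ext ?_) ?_
  · rw [Units.val_pow_eq_pow_val, ZMod.coe_unitOfCoprime, Units.val_one]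
    exact three_cube_mod_thirteen.1
  · intro h
    have h' := congrArg (fun u : (ZMod 13)ˣ => (u : ZMod 13)) h
    simp only [ZMod.coe_unitOfCoprime, Units.val_one] at h'
    exact three_cube_mod_thirteen.2 h'

/-- **`A(3; 13) = 2`** (`ord₁₃(3) = 3` is odd: `2·3·A = φ(13) = 12`). [cite: KoblitzRohrlich1978, §2 Remark 2 (p. 1193)] -/
theorem card_side_three_mod_thirteen : Nat.card {ψ : DirichletCharacter ℂ 13 // ψ.Odd ∧ ψ ((3 : ℕ) : ZMod 13) = 1} = 2 := by
  have h := two_mul_orderOf_mul_card_side_eq_totient (M := 13) (by norm_num) (show (3 : ℕ).Coprime 13 by norm_num)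
    (by rw [orderOf_three_mod_thirteen]; decide)
  rw [orderOf_three_mod_thirteen, Nat.totient_prime (by norm_num)] at h
  omega

/-- **REMARK 2, `#S₀(21) = 1` and `#S(21) = 6`** (so `s(21) = 1/6`). [cite: KoblitzRohrlich1978, §2 Remark 2 (p. 1193)] -/
theorem card_bad_twentyOne_and_card_odd :
    Nat.card {χ : DirichletCharacter ℂ 21 // χ.Odd ∧ bernoulliOneChar χ = 0} = 1 ∧
      Nat.card {χ : DirichletCharacter ℂ 21 // χ.Odd} = 6 := by
  haveI : Fact (Nat.Prime 3) := ⟨by norm_num⟩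
  haveI : Fact (Nat.Prime 7) := ⟨by norm_num⟩
  constructor
  · have h := card_bad_eq_card_sides_twoPrimes (p := 3) (q := 7) (a := 1) (b := 1) (N := 21) (by norm_num) one_ne_zero one_ne_zero
      (by norm_num)
    rw [h, pow_one, pow_one, card_side_three_mod_seven, card_side_seven_mod_three]
  · have h := two_mul_card_odd_eq_totient' (M := 21) (by norm_num)
    have h21 : Nat.totient 21 = 12 := by
      rw [show (21 : ℕ) = 3 * 7 from rfl, Nat.totient_mul (by norm_num), Nat.totient_prime (by norm_num),
        Nat.totient_prime (by norm_num)]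
    omega

/-- **REMARK 2, "`s(21) = 1/6`".** [cite: KoblitzRohrlich1978, §2 Remark 2 (p. 1193)] -/
theorem s_twentyOne :
    (Nat.card {χ : DirichletCharacter ℂ 21 // χ.Odd ∧ bernoulliOneChar χ = 0} : ℚ) /
        Nat.card {χ : DirichletCharacter ℂ 21 // χ.Odd} = 1 / 6 := by
  rw [card_bad_twentyOne_and_card_odd.1, card_bad_twentyOne_and_card_odd.2]
  norm_num

/-- **REMARK 2, `#S₀(39) = 3` and `#S(39) = 12`** (so `s(39) = 1/4`). [cite: KoblitzRohrlich1978, §2 Remark 2 (p. 1193)] -/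
theorem card_bad_thirtyNine_and_card_odd :
    Nat.card {χ : DirichletCharacter ℂ 39 // χ.Odd ∧ bernoulliOneChar χ = 0} = 3 ∧
      Nat.card {χ : DirichletCharacter ℂ 39 // χ.Odd} = 12 := by
  haveI : Fact (Nat.Prime 3) := ⟨by norm_num⟩
  haveI : Fact (Nat.Prime 13) := ⟨by norm_num⟩
  constructor
  · have h := card_bad_eq_card_sides_twoPrimes (p := 3) (q := 13) (a := 1) (b := 1) (N := 39) (by norm_num) one_ne_zero one_ne_zero
      (by norm_num)
    rw [h, pow_one, pow_one, card_side_three_mod_thirteen, card_side_thirteen_mod_three]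
  · have h := two_mul_card_odd_eq_totient' (M := 39) (by norm_num)
    have h39 : Nat.totient 39 = 24 := by
      rw [show (39 : ℕ) = 3 * 13 from rfl, Nat.totient_mul (by norm_num), Nat.totient_prime (by norm_num),
        Nat.totient_prime (by norm_num)]
    omega

/-- **REMARK 2, "`s(39) = 1/4`".** [cite: KoblitzRohrlich1978, §2 Remark 2 (p. 1193)] -/
theorem s_thirtyNine :
    (Nat.card {χ : DirichletCharacter ℂ 39 // χ.Odd ∧ bernoulliOneChar χ = 0} : ℚ) /
        Nat.card {χ : DirichletCharacter ℂ 39 // χ.Odd} = 1 / 4 := by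
  rw [card_bad_thirtyNine_and_card_odd.1, card_bad_thirtyNine_and_card_odd.2]
  norm_num

/-- **The Proposition's inequality FAILS at `N = 21`**: `12·#S₀(21) = 12 = φ(21)` — the hypothesis `12·#S₀(N) < φ(N)` of the odd-level
Theorems 1–2 (`CyclotomicFermatCMTypesOddLevelSimple`) is not available at `21` ("`s(21) = 1/6`", i.e. NOT `< 1/6`).
[cite: KoblitzRohrlich1978, §2 Remark 2 (p. 1193)] -/
theorem not_twelve_mul_card_bad_lt_totient_twentyOne :
    ¬12 * Nat.card {χ : DirichletCharacter ℂ 21 // χ.Odd ∧ bernoulliOneChar χ = 0} < Nat.totient 21 := by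
  have h21 : Nat.totient 21 = 12 := by
    rw [show (21 : ℕ) = 3 * 7 from rfl, Nat.totient_mul (by norm_num), Nat.totient_prime (by norm_num),
      Nat.totient_prime (by norm_num)]
  rw [card_bad_twentyOne_and_card_odd.1, h21]
  omega

/-- **The Proposition's inequality FAILS at `N = 39`**: `12·#S₀(39) = 36 > 24 = φ(39)` ("`s(39) = 1/4`"). [cite: KoblitzRohrlich1978, §2 Remark 2 (p. 1193)] -/
theorem not_twelve_mul_card_bad_lt_totient_thirtyNine :
    ¬12 * Nat.card {χ : DirichletCharacter ℂ 39 // χ.Odd ∧ bernoulliOneChar χ = 0} < Nat.totient 39 := by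
  have h39 : Nat.totient 39 = 24 := by
    rw [show (39 : ℕ) = 3 * 13 from rfl, Nat.totient_mul (by norm_num), Nat.totient_prime (by norm_num),
      Nat.totient_prime (by norm_num)]
  rw [card_bad_thirtyNine_and_card_odd.1, h39]
  omega

/-- **The Proposition's inequality HOLDS at `N = 55`** with the printed margin: `12·#S₀(55) = 36 < 40 = φ(55)` ("`s(55) = 3/20 < 1/6`" —
the extremal relatively prime level). [cite: KoblitzRohrlich1978, §2 Case 1 (p. 1191) and Remark 1 (p. 1192)] -/
theorem twelve_mul_card_bad_lt_totient_fiftyFive :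
    12 * Nat.card {χ : DirichletCharacter ℂ 55 // χ.Odd ∧ bernoulliOneChar χ = 0} < Nat.totient 55 := by
  have h55 : Nat.totient 55 = 40 := by
    rw [show (55 : ℕ) = 5 * 11 from rfl, Nat.totient_mul (by norm_num), Nat.totient_prime (by norm_num),
      Nat.totient_prime (by norm_num)]
  rw [card_bad_fiftyFive, h55]
  omega

end TwentyOneThirtyNine

end CyclotomicFermatCMType

end Literature.AlgebraicGeometry.ComplexMultiplication
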